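import Summits.ResolutionOfSingularities.ResolutionOfSingularities.Theorems.WeightedInvariantLocalWeightedDropNCGameTransport

/-!
# `WeightedInvariant.LocalWeightedDrop`, line `nc-game-transport`: THE RESIDUAL BY NAME — finite-round NC-winnability `HTOT m`,
# and its equivalence with the ℕ-valued radical NC count (`GermNonNCCountRad`)

Crux item stmt-ResolutionOfSingularities-8899 `LocalWeightedDrop` (route `ResolutionOfSingularities/WeightedInvariant`); strategist line
`nc-game-transport` (res-L1-w43-strat-1; transport p507842 `NCTransport.won_of_winsIn`).  [OURS · L1 W4.3, chain w43; game-theoretic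
bookkeeping over `k⟦x⟧`; nothing here is a statement of any manuscript.]

* `NCTransport.HTOT m` — over every algebraically closed field of every prime characteristic, every non-zero germ in `m + 1` variables is
  won by the mover of the NC count game `TameFourTupleDrop.WinsIn GermIsNC` within finitely many rounds.  `HTOT 3` is, literally
  (`htot_three_iff`, `Iff.rfl`), the hypothesis `htot` of `NCTransport.wildWideApexFourStartsWon_of_tot` (the residual W4|₄ after the
  transport), and `∀ n, HTOT (n + 4)` that of `wildWideApexFiveUpStartsWon_of_tot` / `tameWideApexFiveUpStartsWon_of_tot` (W4|₅₊, T″|₅₊)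
  up to binder order (`htot_fiveUp_iff`).  By-name consequences: `localWeightedDrop_of_CJSB_of_htot`, `localWeightedDrop_of_htot`.
* `NCTransport.CountForm m` — in every prime characteristic over every algebraically closed field an ℕ-valued radical non-normal-crossing
  count with free smooth centres exists (`TameFourTupleDrop.GermNonNCCountRad k m`, p502811).
* `countForm_iff_htot : CountForm m ↔ HTOT m` — PROVED: (⇐) is the tree's `germNonNCCountRad_of_winsIn` with heredity (N1)
  `germIsNC_of_dvd_pow`; (⇒) a germ of count `ν b` is won within `ν b` rounds (induction on the count; new positions are non-zero by
  `TupleDropAssembly.slice_ne_zero`).  Reading (strategist's census, gen 3): strengthening the residual to an ℕ-valued invariant form buys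
  nothing — it is the same statement; only a SEMICONTINUOUS / algorithmic invariant would be stronger, and that is the form the catalogued
  barriers `KangarooShadeIncrease`, `WeightedPPinchLoop`, `DirectrixSmallCharacteristic` address.
-/

set_option linter.dupNamespace false -- mandated namespace of this single-conjunct summit

namespace Summit.ResolutionOfSingularities.ResolutionOfSingularities.Theorems

namespace NCTransport

open MvPowerSeries Literature.AlgebraicGeometry.Resolution TameFourTupleDrop

/-! ## The residual, generic in the dimension -/

/-- `HTOT m` (OURS · L1 W4.3, line nc-game-transport): over every algebraically closed field of every prime characteristic, every non-zero
germ in `m + 1` variables is won by the mover of the NC count game (`TameFourTupleDrop.WinsIn GermIsNC`: free smooth centres through the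
point, weights in `{0,1}`, new position = one copy of the exceptional divisor times the sliced strict transform) within some finite number
of rounds.  For `m ≥ 3` this is finite-round pointed embedded resolution of hypersurface germs of dimension `m` in characteristic `p` —
open in print; `m = 2` follows from the Cossart–Jannsen–Saito fact ⟨F-32bR⟩ (`TameFourTupleDrop.exists_winsIn_germIsNC_of_CJSB`). -/
def HTOT (m : ℕ) : Prop :=
  ∀ (p : ℕ), p.Prime → ∀ (k : Type) [Field k] [CharP k p] [IsAlgClosed k],
    ∀ b : MvPowerSeries (Fin (m + 1)) k, b ≠ 0 → ∃ n, WinsIn (m := m) GermIsNC n b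

/-- `HTOT 3` is literally the `htot` hypothesis of `wildWideApexFourStartsWon_of_tot` (the residual W4|₄ after the transport). -/
theorem htot_three_iff :
    HTOT 3 ↔ (∀ (p : ℕ), p.Prime → ∀ (k : Type) [Field k] [CharP k p] [IsAlgClosed k],
      ∀ b : MvPowerSeries (Fin 4) k, b ≠ 0 → ∃ n, WinsIn (m := 3) GermIsNC n b) := Iff.rfl

/-- Transport of `HTOT` along an equality of dimensions. -/
theorem HTOT.cast {m m' : ℕ} (e : m = m') (h : HTOT m) : HTOT m' := e ▸ h

/-- `∀ n, HTOT (n + 4)` is the `htot` hypothesis of `wildWideApexFiveUpStartsWon_of_tot` / `tameWideApexFiveUpStartsWon_of_tot`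
(the residuals W4|₅₊, T″|₅₊ after the transport), up to the order of the binders. -/
theorem htot_fiveUp_iff :
    (∀ n, HTOT (n + 4)) ↔ (∀ (p : ℕ), p.Prime → ∀ (k : Type) [Field k] [CharP k p] [IsAlgClosed k] (n : ℕ),
      ∀ b : MvPowerSeries (Fin (n + 5)) k, b ≠ 0 → ∃ r, WinsIn (m := n + 4) GermIsNC r b) :=
  ⟨fun h p hp k _ _ _ n => h n p hp k, fun h n p hp k _ _ _ => h p hp k n⟩

/-- `HTOT 2` holds modulo the Cossart–Jannsen–Saito fact ⟨F-32bR⟩ (the tree's `exists_winsIn_germIsNC_of_CJSB`, any field). -/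
theorem htot_two_of_CJSB (hCJS : CossartJannsenSaito2020EmbeddedSequenceB.{0}) : HTOT 2 :=
  fun _ _ _ _ _ _ b hb => exists_winsIn_germIsNC_of_CJSB hCJS b hb

/-- BY NAME: modulo ⟨F-32bR⟩, `HTOT` in `≥ 4` variables gives the crux `LocalWeightedDrop` (`localWeightedDrop_of_CJSB_of_tot`). -/
theorem localWeightedDrop_of_CJSB_of_htot (hCJS : CossartJannsenSaito2020EmbeddedSequenceB.{0})
    (h3 : HTOT 3) (h4 : ∀ n, HTOT (n + 4)) : Theses.WeightedInvariant.LocalWeightedDrop :=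
  localWeightedDrop_of_CJSB_of_tot hCJS (fun p hp k _ _ _ m hm b hb => by
    obtain ⟨j, rfl⟩ := Nat.exists_eq_add_of_le hm
    rcases j with _ | j
    · exact h3 p hp k b hb
    · exact (HTOT.cast (by omega : j + 4 = 3 + (j + 1)) (h4 j)) p hp k b hb)

/-- BY NAME: `HTOT` in every number of variables gives the crux `LocalWeightedDrop` outright (`localWeightedDrop_of_tot`). -/
theorem localWeightedDrop_of_htot (h : ∀ m, HTOT m) : Theses.WeightedInvariant.LocalWeightedDrop :=
  localWeightedDrop_of_tot (fun p hp k _ _ _ m b hb => h m p hp k b hb)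

/-! ## The ℕ-invariant form is equivalent -/

/-- `CountForm m`: in every prime characteristic, over every algebraically closed field, there is an ℕ-valued radical
non-normal-crossing count with free smooth centres on germs in `m + 1` variables (the tree's `GermNonNCCountRad k m`). -/
def CountForm (m : ℕ) : Prop :=
  ∀ (p : ℕ), p.Prime → ∀ (k : Type) [Field k] [CharP k p] [IsAlgClosed k], GermNonNCCountRad k m

/-- Totality ⇒ count (the tree's `germNonNCCountRad_of_winsIn` with heredity (N1) `germIsNC_of_dvd_pow`). -/
theorem countForm_of_htot (m : ℕ) (h : HTOT m) : CountForm m :=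
  fun p hp k _ _ _ => germNonNCCountRad_of_winsIn m (fun N b d hd hnc hbd => germIsNC_of_dvd_pow N b d hd hnc hbd) (h p hp k)

/-- Count ⇒ totality: a germ of count `ν b` is won within `ν b` rounds (induction on the count; the new positions are non-zero by
`TupleDropAssembly.slice_ne_zero`). -/
theorem htot_of_countForm (m : ℕ) (h : CountForm m) : HTOT m := by
  intro p hp k _ _ _
  obtain ⟨ν, hν1, -, hν3⟩ := h p hp k
  suffices main : ∀ (n : ℕ) (b : MvPowerSeries (Fin (m + 1)) k), b ≠ 0 → ν b ≤ n → WinsIn GermIsNC n b from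
    fun b hb => ⟨ν b, main _ b hb le_rfl⟩
  intro n
  induction n with
  | zero =>
    intro b hb hle
    exact (winsIn_zero _ _).2 ((hν1 b hb).1 (Nat.le_zero.1 hle))
  | succ n ih =>
    intro b hb hle
    by_cases hnc : GermIsNC b
    · exact winsIn_done hnc _
    obtain ⟨Φ, w, hΦ0, hdet, hw1, hw0, hmv⟩ := hν3 b hb hnc
    refine winsIn_move ⟨hΦ0, hdet, hw1, hw0⟩ ?_
    intro c hc hc0 A G hfac hG
    obtain ⟨i, hci, hlt⟩ := hmv c hc hc0 A G hfac hG
    have hne : X 0 * TupleGame.slice i G ≠ 0 :=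
      mul_ne_zero (MvPowerSeries.prime_X' k (0 : Fin (m + 1))).ne_zero
        (TupleDropAssembly.slice_ne_zero (subst Φ b) w c hc hw1 A G hfac hG i hci)
    exact ⟨i, hci, ih _ hne (by omega)⟩

/-- The ℕ-invariant form IS the residual. -/
theorem countForm_iff_htot (m : ℕ) : CountForm m ↔ HTOT m :=
  ⟨htot_of_countForm m, countForm_of_htot m⟩

/-- In particular, modulo ⟨F-32bR⟩, `CountForm 2` (a radical NC count on `k⟦x₀,x₁,x₂⟧` in every prime characteristic). -/
theorem countForm_two_of_CJSB (hCJS : CossartJannsenSaito2020EmbeddedSequenceB.{0}) : CountForm 2 :=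
  countForm_of_htot 2 (htot_two_of_CJSB hCJS)

end NCTransport

end Summit.ResolutionOfSingularities.ResolutionOfSingularities.Theorems
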